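import Summits.QuantumFields.YangMills.Theorems.ColdExitSC.Negative.UniformExitFalseOfHeavyTwistWindow

/-!
# Heavy-twist wall — extras (file 3 of 3): the PX-squeeze, RUNG 3 typed (asymptotic-freedom window), the SU(2) twist eater

§3b′ `unitMap_decay_of_pinnedExit`: pointed at the slot of record `PX = PinnedExit96.PinnedExitAt (1/24)` — PX pins its witnesses to `a(β)·L < T`, the
window forces `L > β/κ`, hence `a(β)·β < κ·T` along PX's witnesses (PROVED).  §3d `AFTwistWindowSU2 c ρ`: the window with `ℓ(β) = exp(c·β)` — TYPED ONLY
(engine: none in print; it is the shape of the measured deconfinement edge curve); consequences `selector_exp_growth_SU2`, `not_uniformExitAt_of_AFwindowSU2`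
PROVED modulo it.  §3c the single-twist TWIST EATER in `SU(2)` (`eaterA = diag(i, −i)`, `eaterB = [[0, i],[i, 0]]`): membership, anticommutation,
group commutator `= −1`, and `H⁰ = 0` (no traceless matrix commutes with both) — the first kernel-checked rung of S2 `HeavyTwistSU2` (rigidity of the
twist-eating flat connection); sorry-free.

HONEST FRAMING: a NEGATIVE / wall theorem about the seed functional of the IR leaf; it proves NOTHING toward `BalabanLadder.IR` (stmt-QuantumFields-19354) or `IRcof`
(stmt-QuantumFields-26930), whose count stays 0/1; the Yang–Mills mass gap (Clay) is NOT proved anywhere in this tree; R4 closes only the conditional finite-𝕋⁴ rung `BalabanLadder.UV`.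
-/

set_option autoImplicit false

noncomputable section

open Filter Topology MeasureTheory
open Literature.MathematicalPhysics.QuantumFieldTheory Literature.MathematicalPhysics.QuantumLattice
open Summit.QuantumFields.YangMills.Cruxes.IR.ColdPurityBridge (coldDefect)
open Summit.QuantumFields.YangMills.Cruxes.IR.ColdPressurePincer (AFToColdPressure IRnsc)
open Summit.QuantumFields.YangMills.Cruxes.IR.BasinRung (ColdExitAt basin_step24)
open Summit.QuantumFields.YangMills.Cruxes.IR.AspectBootstrap (boxDefect coldDefect_eq_boxDefect axisSymmetric tracePositive)
open Summit.QuantumFields.YangMills.Cruxes.IR.PinnedExit96 (PinnedExitAt)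
open Summit.QuantumFields.YangMills.Cruxes.OSLegsFromFemtoAndGap.DlrCollarTransfer (LowerBounds)

namespace Summit.QuantumFields.YangMills.Theorems.ColdExitSC.Negative.HeavyTwist

/-! ## §3b′ The wall pointed at the SLOT OF RECORD `PX = PinnedExit96.PinnedExitAt (1/24)` (PROVED, lens «negation»): PX pins its witnesses
ABOVE (`a(β)·L ≤ T`), the wall pins them BELOW (`L > β/κ`), so under S1 ∧ window every floor-admissible unit map at `SU(2)` obeys `a(β)·β < κ·T`
eventually — a kernel statement about THE NUMBER's unit maps (true physics: `a(β) ≍ e^{−3π²β/11}`, so no tension; information: PX cannot be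
witnessed through a unit map decaying slower than `1/β`). -/

/-- **PX ∧ S1 ∧ window ⇒ admissible unit maps decay at least like `1/β` (PROVED).** -/
theorem unitMap_decay_of_pinnedExit {κ ρ θ : ℝ} (hB : PurityTwistBoundSU2) (hW : TwistWindowSU2 κ ρ)
    (hθ24 : θ ≤ 1 / 24) (hθρ : 10600 * θ ^ 4 < (1 - ρ) / 2) (hP : PinnedExitAt θ)
    (hsc : SimplyConnectedSpace (Matrix.specialUnitaryGroup (Fin 2) ℂ)) (a : ℝ → ℝ) (ha : ∀ β, 0 < a β)
    (ha0 : Tendsto a atTop (𝓝 0))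
    (hLB : letI : MeasurableSpace (Matrix.specialUnitaryGroup (Fin 2) ℂ) := borel _
      haveI : BorelSpace (Matrix.specialUnitaryGroup (Fin 2) ℂ) := ⟨rfl⟩
      LowerBounds (Matrix.specialUnitaryGroup (Fin 2) ℂ) (fundamentalLatticeRep 2) a) :
    ∃ T : ℝ, ∀ᶠ β : ℝ in atTop, a β * β < κ * T := by
  have hG : IsCompactSimpleLieGroup (Matrix.specialUnitaryGroup (Fin 2) ℂ) :=
    isCompactSimpleLieGroup_specialUnitaryGroup isSimpleCompactGroup_specialUnitaryGroup_holds le_rfl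
  letI : MeasurableSpace (Matrix.specialUnitaryGroup (Fin 2) ℂ) := borel _
  haveI : BorelSpace (Matrix.specialUnitaryGroup (Fin 2) ℂ) := ⟨rfl⟩
  have hW' : TwistWindowAt (fundamentalLatticeRep 2) minusOneSU2 0 κ ρ := hW
  have hκ : 0 < κ := hW'.1
  obtain ⟨T, β₁, hPX⟩ := hP _ hG hsc (fundamentalLatticeRep 2) a ha ha0 hLB
  obtain ⟨β₀, hβ₀⟩ := pure_box_is_long_all (fundamentalLatticeRep 2) hB (twistWindowBelow_of_at _ hW') hθ24 hθρ
  refine ⟨T, ?_⟩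
  filter_upwards [eventually_ge_atTop β₀, eventually_ge_atTop β₁] with β hb0 hb1
  obtain ⟨L, hL, haL, hδ⟩ := hPX β hb1
  have h1 : β / κ < (L : ℝ) := hβ₀ β hb0 L hL hδ
  have h2 : a β * (β / κ) < a β * (L : ℝ) := mul_lt_mul_of_pos_left h1 (ha β)
  have h3 : a β * β = κ * (a β * (β / κ)) := by field_simp
  rw [h3]
  calc κ * (a β * (β / κ)) < κ * (a β * (L : ℝ)) := mul_lt_mul_of_pos_left h2 hκ
    _ ≤ κ * T := mul_le_mul_of_nonneg_left haL hκ.le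

/-! ## §3d RUNG 3 (typed only; engine: NONE in print): the ASYMPTOTIC-FREEDOM twist window `ℓ(β) = e^{cβ}`.
True physics: a cold box `L³ × t` is deconfined (electric flux free, `r ≤ ρ`) iff `t < N_{t,c}(β) = 1/(a(β)T_c) ≍ β^{−p}·e^{3π²β/11}` (`SU(2)`,
two-loop `a(β)Λ_L`), so the window holds below `ℓ(β) = e^{cβ}` for EVERY `c < 3π²/11 ≈ 2.69` and fails for `c > 3π²/11`.  Honest label: this is
«asymptotic freedom down to the confinement scale» — a statement about boxes SMALLER than the correlation length, whose only conceivable engine is a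
Bałaban-class small-field effective action with running coupling (the UV side of the ladder, cf. R4 `BalabanUVStability4`), followed by an extraction
of the electric-flux free energy `t·F_e ≤ C·g_k²`; nothing of the kind is in print or in the tree; DO NOT STAFF — it is typed to record the TRUE shape
of the wall: with S1 it gives `L(β) > e^{cβ}` for every selector (all parities at `θ ≤ 1/24`), which meets line `diagonal-heredity`'s conditional
CEILING `L*(β) ≤ C·2^{β/Δ}` exactly when `Δ ≤ (ln 2)/c`, i.e. heredity steps `Δ > 11·ln 2/(3π²) ≈ 0.2575` are INCONSISTENT with asymptotic freedom
(ideator g1's numerical `D_{0.257}` threshold, now a two-line consequence).  Sources: LuscherWeisz / standard two-loop scaling; deForcrandVonSmekal2002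
(hep-lat/0107018) Fig. 1 (`Z_k(T)` across `T_c`); BorgsSeiler1983 §IV (why RP bounds cannot reach it). -/

/-- **RUNG 3 input (typed only, no engine):** the exponential deconfinement twist window at `SU(2)`, rate `c > 0`, threshold `ρ < 1`. -/
def AFTwistWindowSU2 (c ρ : ℝ) : Prop :=
  letI : MeasurableSpace (Matrix.specialUnitaryGroup (Fin 2) ℂ) := borel _
  haveI : BorelSpace (Matrix.specialUnitaryGroup (Fin 2) ℂ) := ⟨rfl⟩
  0 < c ∧ TwistWindowBelow (fundamentalLatticeRep 2) minusOneSU2 0 (fun β => Real.exp (c * β)) ρ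

/-- **RUNG 3 consequence (PROVED mod S1 + AF window): exponential selector growth, all parities, at `θ ≤ 1/24`** — `L(β) > e^{cβ}` eventually. -/
theorem selector_exp_growth_SU2 {c ρ : ℝ} (hB : PurityTwistBoundSU2) (hW : AFTwistWindowSU2 c ρ) {θ : ℝ}
    (hθ24 : θ ≤ 1 / 24) (hθρ : 10600 * θ ^ 4 < (1 - ρ) / 2) (Lsel : ℝ → ℕ) (h8 : ∀ᶠ β : ℝ in atTop, 8 ≤ Lsel β)
    (hpure : letI : MeasurableSpace (Matrix.specialUnitaryGroup (Fin 2) ℂ) := borel _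
      haveI : BorelSpace (Matrix.specialUnitaryGroup (Fin 2) ℂ) := ⟨rfl⟩
      ∀ᶠ β : ℝ in atTop, coldDefect (fundamentalLatticeRep 2).ρ β (Lsel β) ≤ θ) :
    ∀ᶠ β : ℝ in atTop, Real.exp (c * β) < (Lsel β : ℝ) := by
  letI : MeasurableSpace (Matrix.specialUnitaryGroup (Fin 2) ℂ) := borel _
  haveI : BorelSpace (Matrix.specialUnitaryGroup (Fin 2) ℂ) := ⟨rfl⟩
  have hW' : 0 < c ∧ TwistWindowBelow (fundamentalLatticeRep 2) minusOneSU2 0 (fun β => Real.exp (c * β)) ρ := hW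
  exact selector_outgrows_all (fundamentalLatticeRep 2) hB hW'.2 hθ24 hθρ Lsel h8 hpure

/-- **RUNG 3 ⇒ no β-uniform witness at any `θ ≤ 1/24` with `10600θ⁴ < (1 − ρ)/2`, parity-free (PROVED mod S1 + AF window).** (Weaker than what
RUNG 2 already gives unconditionally-in-principle; recorded for the ladder.) -/
theorem not_uniformExitAt_of_AFwindowSU2 {c ρ : ℝ} (hB : PurityTwistBoundSU2) (hW : AFTwistWindowSU2 c ρ)
    (hsc : SimplyConnectedSpace (Matrix.specialUnitaryGroup (Fin 2) ℂ)) {θ : ℝ} (hθ24 : θ ≤ 1 / 24)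
    (hθρ : 10600 * θ ^ 4 < (1 - ρ) / 2) : ¬ UniformExitAt θ := by
  intro hU
  have hG : IsCompactSimpleLieGroup (Matrix.specialUnitaryGroup (Fin 2) ℂ) :=
    isCompactSimpleLieGroup_specialUnitaryGroup isSimpleCompactGroup_specialUnitaryGroup_holds le_rfl
  letI : MeasurableSpace (Matrix.specialUnitaryGroup (Fin 2) ℂ) := borel _
  haveI : BorelSpace (Matrix.specialUnitaryGroup (Fin 2) ℂ) := ⟨rfl⟩
  have hUr : UniformExitAtRep (fundamentalLatticeRep 2) θ := hU _ hG hsc (fundamentalLatticeRep 2)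
  have hW' : 0 < c ∧ TwistWindowBelow (fundamentalLatticeRep 2) minusOneSU2 0 (fun β => Real.exp (c * β)) ρ := hW
  have hℓ : Tendsto (fun β : ℝ => Real.exp (c * β)) atTop atTop :=
    Real.tendsto_exp_atTop.comp (tendsto_id.const_mul_atTop hW'.1)
  exact not_uniformExitAtRep_of_window (fundamentalLatticeRep 2) hB hW'.2 hℓ hθ24 hθρ hUr

/-! ## §3c FIRST KERNEL-CHECKED RUNG OF S2 (rev 3, PROVED, sorry-free): the single-twist TWIST EATER exists in `SU(2)` and is rigid in
degree 0.  Holonomies `A = iσ₃` (across the `x₀ = 0` sheet) and `B = iσ₁` (across the `x₃ = 0` sheet): both in `SU(2)` (`eaterA_mem`,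
`eaterB_mem`), `A² = B² = −1`, `AB = −BA` (`eater_anticomm`), commutator `A B A⁻¹ B⁻¹ = −1` (`eater_commutator`: the crossing plaquette's
holonomy is the centre element, which the twist factor `−1` makes weight-maximal ⇒ the twist-eater configuration has ZERO action, so `min S^{tw} = 0`
and S2 is a genuine Laplace count, not an energy gap), and `H⁰ = 0` (`H0_vanishes`: no non-zero traceless matrix commutes with both — the
stabiliser is discrete).  What remains of the rigidity input of S2 is `H¹ = 0` (the lattice Koszul count: `v₁ = v₂ = 0` forced,
`(A₀ − 1)v₃ = (A₃ − 1)v₀` leaves 3 dimensions, killed by the 3-dimensional gauge image — crit-3's independent derivation 06:27:19Z) and the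
two-sided Gaussian comparison; those are the content of `stub_heavyTwist`. -/

namespace TwistEater

open Complex

/-- Twist-eater holonomy across the `x₀ = 0` sheet: `iσ₃`. -/
def eaterA : Matrix (Fin 2) (Fin 2) ℂ := !![I, 0; 0, -I]
/-- Twist-eater holonomy across the `x₃ = 0` sheet: `iσ₁`. -/
def eaterB : Matrix (Fin 2) (Fin 2) ℂ := !![0, I; I, 0]

/-- The twist-eating relation: the two holonomies commute up to the centre element `−1`. -/
theorem eater_anticomm : eaterA * eaterB = -(eaterB * eaterA) := by
  ext i j
  fin_cases i <;> fin_cases j <;> simp [eaterA, eaterB]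

/-- `A² = −1` for the first twist-eater holonomy. -/
theorem eaterA_sq : eaterA * eaterA = -1 := by
  ext i j
  fin_cases i <;> fin_cases j <;> simp [eaterA, Matrix.one_fin_two]

/-- `B² = −1` for the second twist-eater holonomy. -/
theorem eaterB_sq : eaterB * eaterB = -1 := by
  ext i j
  fin_cases i <;> fin_cases j <;> simp [eaterB, Matrix.one_fin_two]

/-- `H⁰ = 0` at the twist eater: no non-zero traceless `2×2` matrix commutes with both holonomies (so the stabiliser of the
twist-eating pair in `SU(2)/{±1}` is discrete: the flat connection is INFINITESIMALLY RIGID in degree 0). -/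
theorem H0_vanishes (X : Matrix (Fin 2) (Fin 2) ℂ) (htr : X 0 0 + X 1 1 = 0)
    (hA : eaterA * X = X * eaterA) (hB : eaterB * X = X * eaterB) : X = 0 := by
  rw [Matrix.eta_fin_two X] at hA hB
  simp only [eaterA, eaterB, Matrix.mul_fin_two] at hA hB
  have h01 := congrFun (congrFun hA 0) 1
  have h10 := congrFun (congrFun hA 1) 0
  have h00 := congrFun (congrFun hB 0) 0
  have h01' := congrFun (congrFun hB 0) 1
  simp at h01 h10 h00 h01'
  -- h01 : I * X 0 1 = -(X 0 1 * I)   h10 : -(I * X 1 0) = X 1 0 * I   h00 : I * X 1 0 = X 0 1 * I   h01' : I * X 1 1 = X 0 0 * I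
  have e01 : X 0 1 = 0 := by
    have h2 : (2 * I) * X 0 1 = 0 := by linear_combination h01
    simpa [Complex.I_ne_zero] using h2
  have e10 : X 1 0 = 0 := by
    have h2 : (2 * I) * X 1 0 = 0 := by linear_combination -h10
    simpa [Complex.I_ne_zero] using h2
  have e11 : X 1 1 = X 0 0 := by
    have h2 : I * (X 1 1 - X 0 0) = 0 := by linear_combination h01'
    have := mul_eq_zero.mp h2
    simpa [Complex.I_ne_zero, sub_eq_zero] using this
  have e00 : X 0 0 = 0 := by
    have h2 : (2 : ℂ) * X 0 0 = 0 := by linear_combination htr - e11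
    simpa using h2
  ext i j
  fin_cases i <;> fin_cases j <;> simp [e01, e10, e11, e00]

/-- `A⁻¹ = −A`, `B⁻¹ = −B` (from `A² = B² = −1`), so the commutator `A B A⁻¹ B⁻¹` is `A B (−A) (−B)`; it equals the centre element `−1`:
the plaquette at the crossing of the two twisted sheets has holonomy `−1`, which the twist factor `−1` turns into weight-maximal —
every plaquette of the twist-eater configuration has maximal Boltzmann weight (zero action). -/
theorem eater_commutator : eaterA * eaterB * (-eaterA) * (-eaterB) = -1 := by
  ext i j
  fin_cases i <;> fin_cases j <;> simp [eaterA, eaterB, Matrix.one_fin_two]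

/-- The first twist-eater holonomy lies in `SU(2)`. -/
theorem eaterA_mem : eaterA ∈ Matrix.specialUnitaryGroup (Fin 2) ℂ := by
  rw [Matrix.mem_specialUnitaryGroup_iff, Matrix.mem_unitaryGroup_iff]
  refine ⟨?_, ?_⟩
  · ext i j
    fin_cases i <;> fin_cases j <;>
      simp [eaterA, Matrix.mul_apply, Fin.sum_univ_two, Matrix.star_eq_conjTranspose, Matrix.conjTranspose_apply]
  · simp [eaterA, Matrix.det_fin_two_of]

/-- The second twist-eater holonomy lies in `SU(2)`. -/
theorem eaterB_mem : eaterB ∈ Matrix.specialUnitaryGroup (Fin 2) ℂ := by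
  rw [Matrix.mem_specialUnitaryGroup_iff, Matrix.mem_unitaryGroup_iff]
  refine ⟨?_, ?_⟩
  · ext i j
    fin_cases i <;> fin_cases j <;>
      simp [eaterB, Matrix.mul_apply, Fin.sum_univ_two, Matrix.star_eq_conjTranspose, Matrix.conjTranspose_apply]
  · simp [eaterB, Matrix.det_fin_two_of]

end TwistEater

end Summit.QuantumFields.YangMills.Theorems.ColdExitSC.Negative.HeavyTwist
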